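import Summits.NavierStokesRegularity.FunctionalMining.StretchingWrapEnvelope
import Literature.Analysis.FluidPDE.MikadoRescaled
import Literature.Analysis.FluidPDE.AlexakisDoeringProofs
import Literature.Analysis.FluidPDE.EulerReynoldsMollification
import Literature.Analysis.FunctionSpaces.TorusTestFunction
import HarnessLib

/-!
# K1-Q1, the wrap blueprint: towards node N2 `ConfinementLemma` — curl calculus and perturbation algebra

Cell `pub-nsfunc` (host summit NavierStokesRegularity, topic `FunctionalMining`), prove seat gen 5, on the bank seat's
`WRAP-KERNEL-BLUEPRINT.md` §5 (node N2 typed by the dictionary seat in `StretchingWrapIdentity.lean`).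
**Search for candidate a priori estimates; no regularity claim.** Static facts about smooth fields on `T³`.

This part: the curl field `curlField A` (dictionary seat's `vorticityComp` packaged as a vector field) is smooth and
divergence free for smooth `A`; its components and gradient in terms of second partial derivatives; the rescaled
potential `A_m(x) = m⁻²A(m•x)` and its derivatives; the confined potential `B = E•A_m` and the decomposition
`∇(curl B)(x) = E(x)·∇F(m•x) + R(x)` with an explicit remainder `R` built from `∇E, ∇²E, A, ∇A`; and the
perturbation algebra on `3×3` gradient matrices used to compare the statistics of `curl B` with those of `F`:
`|prodBC Y − e³·prodBC X| ≤ 162ρ(β+ρ)²`, `|vort Y i² − e²·vort X i²| ≤ 8ρ(β+ρ)`, `∑ vort Y i² ≤ (1+4ρ)²`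
when `|X| ≤ β`, `|Y − eX| ≤ ρ` entrywise, `0 ≤ e ≤ 1`, `∑ vort X i² ≤ 1`.
-/

noncomputable section

open MeasureTheory Set Filter Topology Function
open scoped InnerProductSpace ContDiff

namespace Summit.NavierStokesRegularity.FunctionalMining

open Literature.Analysis Literature.Analysis.FunctionSpaces Literature.Analysis.FunctionSpaces.Torus
open Literature.Analysis.FluidPDE Literature.Analysis.FluidPDE.Torus

namespace Confinement

open CellularStretching WrapStretching

/-! ## 1. The curl field of a smooth potential -/

/-- The successor indices `i+1`, `i+2` in `Fin 3`. [ours; bookkeeping] -/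
theorem vorticityComp_eq (A : UnitAddTorus (Fin 3) → EuclideanSpace ℝ (Fin 3)) (x : UnitAddTorus (Fin 3)) (i : Fin 3) :
    vorticityComp A x i =
      Torus.partialDeriv (i + 1) A x (i + 2) - Torus.partialDeriv (i + 2) A x (i + 1) := by
  fin_cases i <;> simp [vorticityComp]

/-- Components of `curlField`. [ours; bookkeeping] -/
theorem curlField_apply (A : UnitAddTorus (Fin 3) → EuclideanSpace ℝ (Fin 3)) (x : UnitAddTorus (Fin 3)) (i : Fin 3) :
    curlField A x i = Torus.partialDeriv (i + 1) A x (i + 2) - Torus.partialDeriv (i + 2) A x (i + 1) := by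
  rw [curlField]
  exact vorticityComp_eq A x i

/-- The component function `x ↦ (∂ₐA)_b(x)` of a smooth field is smooth. [folklore] -/
theorem isSmooth_partialDeriv_apply {A : UnitAddTorus (Fin 3) → EuclideanSpace ℝ (Fin 3)} (hA : IsSmooth A)
    (a b : Fin 3) : IsSmooth fun x => Torus.partialDeriv a A x b :=
  (hA.partialDeriv a).apply b

/-- **`curlField A` is smooth** for smooth `A`. [ours; elementary] -/
theorem isSmooth_curlField {A : UnitAddTorus (Fin 3) → EuclideanSpace ℝ (Fin 3)} (hA : IsSmooth A) :
    IsSmooth (curlField A) := by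
  rw [isSmooth_euclidean_iff]
  intro i
  have h : (fun x => curlField A x i) = fun x =>
      Torus.partialDeriv (i + 1) A x (i + 2) - Torus.partialDeriv (i + 2) A x (i + 1) :=
    funext fun x => curlField_apply A x i
  rw [h]
  exact (isSmooth_partialDeriv_apply hA _ _).sub (isSmooth_partialDeriv_apply hA _ _)

/-- Second partial derivatives of components: `∂_j (x ↦ (∂ₐA)_b) = (∂_j∂ₐA)_b`. [folklore] -/
theorem partialDeriv_partialDeriv_apply {A : UnitAddTorus (Fin 3) → EuclideanSpace ℝ (Fin 3)} (hA : IsSmooth A)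
    (j a b : Fin 3) (x : UnitAddTorus (Fin 3)) :
    Torus.partialDeriv j (fun y => Torus.partialDeriv a A y b) x = Torus.partialDeriv j (Torus.partialDeriv a A) x b :=
  partialDeriv_apply_coord ((hA.partialDeriv a).isContDiff (by simp)) j x b

/-- **Gradient of the curl field**: `∂_j(curl A)_i = (∂_j∂_{i+1}A)_{i+2} − (∂_j∂_{i+2}A)_{i+1}`. [ours; elementary] -/
theorem gradAt_curlField {A : UnitAddTorus (Fin 3) → EuclideanSpace ℝ (Fin 3)} (hA : IsSmooth A)
    (x : UnitAddTorus (Fin 3)) (i j : Fin 3) :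
    gradAt (curlField A) x i j =
      Torus.partialDeriv j (Torus.partialDeriv (i + 1) A) x (i + 2) -
        Torus.partialDeriv j (Torus.partialDeriv (i + 2) A) x (i + 1) := by
  unfold gradAt
  rw [← partialDeriv_apply_coord ((isSmooth_curlField hA).isContDiff (by simp)) j x i]
  have h : (fun y => curlField A y i) = (fun y => Torus.partialDeriv (i + 1) A y (i + 2)) -
      fun y => Torus.partialDeriv (i + 2) A y (i + 1) :=
    funext fun y => curlField_apply A y i
  rw [h, partialDeriv_sub ((isSmooth_partialDeriv_apply hA _ _).isContDiff (by simp))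
    ((isSmooth_partialDeriv_apply hA _ _).isContDiff (by simp)), Pi.sub_apply,
    partialDeriv_partialDeriv_apply hA, partialDeriv_partialDeriv_apply hA]

/-- **`curlField A` is divergence free** (mixed partials commute). [ours; elementary] -/
theorem isDivFree_curlField {A : UnitAddTorus (Fin 3) → EuclideanSpace ℝ (Fin 3)} (hA : IsSmooth A) :
    IsDivFree (curlField A) := by
  intro x
  unfold Torus.divergence
  have h : ∀ i, Torus.partialDeriv i (fun y => curlField A y i) x = gradAt (curlField A) x i i := fun i => by
    rw [gradAt, partialDeriv_apply_coord ((isSmooth_curlField hA).isContDiff (by simp))]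
  simp only [h, gradAt_curlField hA, Fin.sum_univ_three]
  have c := fun a b => partialDeriv_comm hA a b x
  simp only [show (0 : Fin 3) + 1 = 1 from rfl, show (0 : Fin 3) + 2 = 2 from rfl, show (1 : Fin 3) + 1 = 2 from rfl,
    show (1 : Fin 3) + 2 = 0 from rfl, show (2 : Fin 3) + 1 = 0 from rfl, show (2 : Fin 3) + 2 = 1 from rfl]
  rw [c 0 1, c 1 2, c 2 0]
  ring

/-! ## 2. The rescaled potential `A_m(x) = m⁻²A(m•x)` -/

section Rescale

variable (A : UnitAddTorus (Fin 3) → EuclideanSpace ℝ (Fin 3)) (m : ℕ)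

/-- The rescaled potential `A_m(x) = m⁻²·A(m•x)`. [ours] -/
def rescale (A : UnitAddTorus (Fin 3) → EuclideanSpace ℝ (Fin 3)) (m : ℕ) (x : UnitAddTorus (Fin 3)) :
    EuclideanSpace ℝ (Fin 3) :=
  ((m : ℝ) ^ 2)⁻¹ • A (m • x)

variable {A}

/-- `A_m` is smooth. [folklore] -/
theorem isSmooth_rescale (hA : IsSmooth A) : IsSmooth (rescale A m) :=
  (isSmooth_comp_nsmul hA m).smul _

/-- **`∂_jA_m(x) = m⁻¹·(∂_jA)(m•x)`.** [folklore] -/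
theorem partialDeriv_rescale (hA : IsSmooth A) (j : Fin 3) (x : UnitAddTorus (Fin 3)) :
    Torus.partialDeriv j (rescale A m) x = ((m : ℝ))⁻¹ • Torus.partialDeriv j A (m • x) := by
  have h1 : IsContDiff 1 (fun y => A (m • y)) := (isSmooth_comp_nsmul hA m).isContDiff (by simp)
  rw [show rescale A m = ((m : ℝ) ^ 2)⁻¹ • fun y => A (m • y) from rfl, partialDeriv_const_smul h1, Pi.smul_apply,
    partialDeriv_comp_nsmul, smul_smul]
  rcases Nat.eq_zero_or_pos m with hm | hm
  · subst hm; simp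
  · have hm' : (m : ℝ) ≠ 0 := by exact_mod_cast hm.ne'
    congr 1
    field_simp

/-- **`∂_k∂_jA_m(x) = (∂_k∂_jA)(m•x)`.** [folklore] -/
theorem partialDeriv_partialDeriv_rescale (hA : IsSmooth A) (k j : Fin 3) (x : UnitAddTorus (Fin 3)) :
    Torus.partialDeriv k (Torus.partialDeriv j (rescale A m)) x =
      (if m = 0 then 0 else Torus.partialDeriv k (Torus.partialDeriv j A) (m • x)) := by
  have hfun : Torus.partialDeriv j (rescale A m) = ((m : ℝ))⁻¹ • fun y => Torus.partialDeriv j A (m • y) := by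
    funext y; rw [partialDeriv_rescale m hA]; rfl
  have h1 : IsContDiff 1 (fun y => Torus.partialDeriv j A (m • y)) :=
    (isSmooth_comp_nsmul (hA.partialDeriv j) m).isContDiff (by simp)
  rw [hfun, partialDeriv_const_smul h1, Pi.smul_apply, partialDeriv_comp_nsmul, smul_smul]
  rcases Nat.eq_zero_or_pos m with hm | hm
  · subst hm; simp
  · have hm' : (m : ℝ) ≠ 0 := by exact_mod_cast hm.ne'
    rw [if_neg hm.ne', inv_mul_cancel₀ hm', one_smul]

/-- Sup bound transfer: `‖A_m(x)‖ ≤ ‖A‖∞/m²`. [folklore] -/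
theorem norm_rescale_le {C : ℝ} (hC : ∀ x, ‖A x‖ ≤ C) (x : UnitAddTorus (Fin 3)) :
    ‖rescale A m x‖ ≤ ((m : ℝ) ^ 2)⁻¹ * C := by
  rw [rescale, norm_smul, Real.norm_eq_abs, abs_inv, abs_pow, Nat.abs_cast]
  exact mul_le_mul_of_nonneg_left (hC _) (by positivity)

end Rescale

/-! ## 3. The confined potential `B = E • A_m` and the gradient of its curl -/

section Confined

variable {E : UnitAddTorus (Fin 3) → ℝ} {A : UnitAddTorus (Fin 3) → EuclideanSpace ℝ (Fin 3)}

/-- The confined potential `B(x) = E(x)•V(x)`. [ours] -/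
def confine (E : UnitAddTorus (Fin 3) → ℝ) (V : UnitAddTorus (Fin 3) → EuclideanSpace ℝ (Fin 3))
    (x : UnitAddTorus (Fin 3)) : EuclideanSpace ℝ (Fin 3) :=
  E x • V x

/-- `B` is smooth. [folklore] -/
theorem isSmooth_confine (hE : IsSmooth E) {V : UnitAddTorus (Fin 3) → EuclideanSpace ℝ (Fin 3)} (hV : IsSmooth V) :
    IsSmooth (confine E V) :=
  hE.smul' hV

/-- **First derivatives of `B = E•V`**: `∂ₐB = (∂ₐE)•V + E•∂ₐV`. [folklore] -/
theorem partialDeriv_confine (hE : IsSmooth E) {V : UnitAddTorus (Fin 3) → EuclideanSpace ℝ (Fin 3)}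
    (hV : IsSmooth V) (a : Fin 3) (x : UnitAddTorus (Fin 3)) :
    Torus.partialDeriv a (confine E V) x = Torus.partialDeriv a E x • V x + E x • Torus.partialDeriv a V x := by
  rw [show confine E V = fun y => E y • V y from rfl,
    partialDeriv_smul (hE.isContDiff (by simp)) (hV.isContDiff (by simp)), add_comm]

/-- **Second derivatives of `B = E•V`**:
`∂_j∂ₐB = (∂_j∂ₐE)•V + (∂ₐE)•∂_jV + (∂_jE)•∂ₐV + E•∂_j∂ₐV`. [folklore] -/
theorem partialDeriv_partialDeriv_confine (hE : IsSmooth E) {V : UnitAddTorus (Fin 3) → EuclideanSpace ℝ (Fin 3)}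
    (hV : IsSmooth V) (j a : Fin 3) (x : UnitAddTorus (Fin 3)) :
    Torus.partialDeriv j (Torus.partialDeriv a (confine E V)) x =
      Torus.partialDeriv j (Torus.partialDeriv a E) x • V x + Torus.partialDeriv a E x • Torus.partialDeriv j V x +
        (Torus.partialDeriv j E x • Torus.partialDeriv a V x + E x • Torus.partialDeriv j (Torus.partialDeriv a V) x) := by
  have hfun : Torus.partialDeriv a (confine E V) =
      (fun y => Torus.partialDeriv a E y • V y) + fun y => E y • Torus.partialDeriv a V y := by
    funext y; rw [partialDeriv_confine hE hV]; rfl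
  have h1 : IsContDiff 1 (Torus.partialDeriv a E) := (hE.partialDeriv a).isContDiff (by simp)
  have h2 : IsContDiff 1 V := hV.isContDiff (by simp)
  have h3 : IsContDiff 1 E := hE.isContDiff (by simp)
  have h4 : IsContDiff 1 (Torus.partialDeriv a V) := (hV.partialDeriv a).isContDiff (by simp)
  have hs1 : IsContDiff 1 (fun y => Torus.partialDeriv a E y • V y) := ContDiff.smul h1 h2
  have hs2 : IsContDiff 1 (fun y => E y • Torus.partialDeriv a V y) := ContDiff.smul h3 h4
  rw [hfun, partialDeriv_add hs1 hs2, Pi.add_apply, partialDeriv_smul h1 h2, partialDeriv_smul h3 h4]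
  abel

/-- **The gradient of `curl(E•A_m)` splits into the main term `E(x)·∇F(m•x)` (`F = curl A`) and a remainder**
collecting the terms with a derivative on `E`:
`R_{ij} = (∂_j∂_{i+1}E)A_{m,i+2} − (∂_j∂_{i+2}E)A_{m,i+1} + (∂_{i+1}E)(∂_jA_m)_{i+2} − (∂_{i+2}E)(∂_jA_m)_{i+1}`
`+ (∂_jE)(curl A_m)_i`. [ours] -/
theorem gradAt_curl_confine (hE : IsSmooth E) (hA : IsSmooth A) {m : ℕ} (hm : m ≠ 0)
    (x : UnitAddTorus (Fin 3)) (i j : Fin 3) :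
    gradAt (curlField (confine E (rescale A m))) x i j =
      E x * gradAt (curlField A) (m • x) i j +
      (Torus.partialDeriv j (Torus.partialDeriv (i + 1) E) x * rescale A m x (i + 2) -
          Torus.partialDeriv j (Torus.partialDeriv (i + 2) E) x * rescale A m x (i + 1) +
        (Torus.partialDeriv (i + 1) E x * Torus.partialDeriv j (rescale A m) x (i + 2) -
          Torus.partialDeriv (i + 2) E x * Torus.partialDeriv j (rescale A m) x (i + 1)) +
        Torus.partialDeriv j E x * curlField (rescale A m) x i) := by
  have hV := isSmooth_rescale m hA
  rw [gradAt_curlField (isSmooth_confine hE hV), gradAt_curlField hA,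
    partialDeriv_partialDeriv_confine hE hV, partialDeriv_partialDeriv_confine hE hV,
    partialDeriv_partialDeriv_rescale m hA, partialDeriv_partialDeriv_rescale m hA, if_neg hm, if_neg hm,
    curlField_apply]
  simp only [PiLp.add_apply, PiLp.smul_apply, smul_eq_mul]
  ring

end Confined

/-! ## 4. Perturbation algebra for gradient matrices -/

/-- `prodBC` as a single triple sum. [ours; bookkeeping] -/
theorem prodBC_eq_sum3 (X : Fin 3 → Fin 3 → ℝ) :
    prodBC X = ∑ a, ∑ b, ∑ c, (X a b * X b c * X c a - X a c * X b c * X b a) := by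
  simp only [prodBC, Fin.sum_univ_three]
  ring

/-- Triple sums: a termwise bound gives `27·b`. [folklore] -/
theorem abs_sum3_le {f : Fin 3 → Fin 3 → Fin 3 → ℝ} {b : ℝ} (h : ∀ i j k, |f i j k| ≤ b) :
    |∑ i, ∑ j, ∑ k, f i j k| ≤ 27 * b := by
  calc |∑ i, ∑ j, ∑ k, f i j k| ≤ ∑ i, |∑ j, ∑ k, f i j k| := Finset.abs_sum_le_sum_abs _ _
    _ ≤ ∑ i, ∑ j, |∑ k, f i j k| := Finset.sum_le_sum fun i _ => Finset.abs_sum_le_sum_abs _ _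
    _ ≤ ∑ i, ∑ j, ∑ k, |f i j k| :=
        Finset.sum_le_sum fun i _ => Finset.sum_le_sum fun j _ => Finset.abs_sum_le_sum_abs _ _
    _ ≤ ∑ _i : Fin 3, ∑ _j : Fin 3, ∑ _k : Fin 3, b :=
        Finset.sum_le_sum fun i _ => Finset.sum_le_sum fun j _ => Finset.sum_le_sum fun k _ => h i j k
    _ = 27 * b := by simp; ring

/-- **Cubic monomials under perturbation**: `|y₁y₂y₃ − (ex₁)(ex₂)(ex₃)| ≤ 3ρ(β+ρ)²` when `|xₖ| ≤ β`,
`|yₖ − exₖ| ≤ ρ`, `|e| ≤ 1`. [folklore] -/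
theorem abs_mul3_sub_le {e x₁ x₂ x₃ y₁ y₂ y₃ β ρ : ℝ} (he : |e| ≤ 1) (h₁ : |x₁| ≤ β) (h₂ : |x₂| ≤ β) (h₃ : |x₃| ≤ β)
    (k₁ : |y₁ - e * x₁| ≤ ρ) (k₂ : |y₂ - e * x₂| ≤ ρ) (k₃ : |y₃ - e * x₃| ≤ ρ) :
    |y₁ * y₂ * y₃ - e * x₁ * (e * x₂) * (e * x₃)| ≤ 3 * ρ * (β + ρ) ^ 2 := by
  have hβ : 0 ≤ β := (abs_nonneg _).trans h₁
  have hρ : 0 ≤ ρ := (abs_nonneg _).trans k₁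
  have hex : ∀ {x}, |x| ≤ β → |e * x| ≤ β := fun hx => by
    rw [abs_mul]; exact (mul_le_mul he hx (abs_nonneg _) zero_le_one).trans (by rw [one_mul])
  have hy : ∀ {x y : ℝ}, |x| ≤ β → |y - e * x| ≤ ρ → |y| ≤ β + ρ := fun {x y} hx hyx => by
    calc |y| = |e * x + (y - e * x)| := by ring_nf
      _ ≤ |e * x| + |y - e * x| := abs_add_le _ _
      _ ≤ β + ρ := add_le_add (hex hx) hyx
  -- telescoping: y₁y₂y₃ − X₁X₂X₃ = (y₁−X₁)y₂y₃ + X₁(y₂−X₂)y₃ + X₁X₂(y₃−X₃)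
  have e1 : y₁ * y₂ * y₃ - e * x₁ * (e * x₂) * (e * x₃) =
      (y₁ - e * x₁) * y₂ * y₃ + e * x₁ * (y₂ - e * x₂) * y₃ + e * x₁ * (e * x₂) * (y₃ - e * x₃) := by ring
  rw [e1]
  have t1 : |(y₁ - e * x₁) * y₂ * y₃| ≤ ρ * (β + ρ) * (β + ρ) := by
    rw [abs_mul, abs_mul]
    exact mul_le_mul (mul_le_mul k₁ (hy h₂ k₂) (abs_nonneg _) hρ) (hy h₃ k₃) (abs_nonneg _) (by positivity)
  have t2 : |e * x₁ * (y₂ - e * x₂) * y₃| ≤ β * ρ * (β + ρ) := by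
    rw [abs_mul, abs_mul]
    exact mul_le_mul (mul_le_mul (hex h₁) k₂ (abs_nonneg _) hβ) (hy h₃ k₃) (abs_nonneg _) (by positivity)
  have t3 : |e * x₁ * (e * x₂) * (y₃ - e * x₃)| ≤ β * β * ρ := by
    rw [abs_mul, abs_mul]
    exact mul_le_mul (mul_le_mul (hex h₁) (hex h₂) (abs_nonneg _) hβ) k₃ (abs_nonneg _) (by positivity)
  calc _ ≤ |(y₁ - e * x₁) * y₂ * y₃| + |e * x₁ * (y₂ - e * x₂) * y₃| + |e * x₁ * (e * x₂) * (y₃ - e * x₃)| :=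
        abs_add_three _ _ _
    _ ≤ ρ * (β + ρ) * (β + ρ) + β * ρ * (β + ρ) + β * β * ρ := by linarith
    _ ≤ 3 * ρ * (β + ρ) ^ 2 := by nlinarith [mul_nonneg hβ hρ, mul_nonneg hρ hρ]

/-- **The production density under perturbation**: `|prodBC Y − e³·prodBC X| ≤ 162ρ(β+ρ)²`. [ours] -/
theorem abs_prodBC_sub_le {X Y : Fin 3 → Fin 3 → ℝ} {e β ρ : ℝ} (he : |e| ≤ 1) (hX : ∀ i j, |X i j| ≤ β)
    (hY : ∀ i j, |Y i j - e * X i j| ≤ ρ) :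
    |prodBC Y - e ^ 3 * prodBC X| ≤ 162 * ρ * (β + ρ) ^ 2 := by
  have hscale : e ^ 3 * prodBC X = prodBC (fun i j => e * X i j) := by
    simp only [prodBC, Fin.sum_univ_three]; ring
  rw [hscale, prodBC_eq_sum3, prodBC_eq_sum3, ← Finset.sum_sub_distrib]
  simp_rw [← Finset.sum_sub_distrib]
  have hterm : ∀ a b c : Fin 3, |(Y a b * Y b c * Y c a - Y a c * Y b c * Y b a) -
      (e * X a b * (e * X b c) * (e * X c a) - e * X a c * (e * X b c) * (e * X b a))| ≤ 2 * (3 * ρ * (β + ρ) ^ 2) := by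
    intro a b c
    have h1 := abs_mul3_sub_le he (hX a b) (hX b c) (hX c a) (hY a b) (hY b c) (hY c a)
    have h2 := abs_mul3_sub_le he (hX a c) (hX b c) (hX b a) (hY a c) (hY b c) (hY b a)
    calc _ = |(Y a b * Y b c * Y c a - e * X a b * (e * X b c) * (e * X c a)) -
          (Y a c * Y b c * Y b a - e * X a c * (e * X b c) * (e * X b a))| := by ring_nf
      _ ≤ _ := (abs_sub _ _).trans (by linarith)
  exact (abs_sum3_le hterm).trans (by ring_nf; rfl)

/-- `vort` is linear: `vort Y − e•vort X = vort (Y − eX)`, hence `|vort Y i − e·vort X i| ≤ 2ρ`. [ours; elementary] -/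
theorem abs_vort_sub_le {X Y : Fin 3 → Fin 3 → ℝ} {e ρ : ℝ} (hY : ∀ i j, |Y i j - e * X i j| ≤ ρ) (i : Fin 3) :
    |vort Y i - e * vort X i| ≤ 2 * ρ := by
  fin_cases i
  · show |(Y 2 1 - Y 1 2) - e * (X 2 1 - X 1 2)| ≤ 2 * ρ
    calc |Y 2 1 - Y 1 2 - e * (X 2 1 - X 1 2)| = |(Y 2 1 - e * X 2 1) - (Y 1 2 - e * X 1 2)| := by ring_nf
      _ ≤ |Y 2 1 - e * X 2 1| + |Y 1 2 - e * X 1 2| := abs_sub _ _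
      _ ≤ 2 * ρ := by linarith [hY 2 1, hY 1 2]
  · show |(Y 0 2 - Y 2 0) - e * (X 0 2 - X 2 0)| ≤ 2 * ρ
    calc |Y 0 2 - Y 2 0 - e * (X 0 2 - X 2 0)| = |(Y 0 2 - e * X 0 2) - (Y 2 0 - e * X 2 0)| := by ring_nf
      _ ≤ |Y 0 2 - e * X 0 2| + |Y 2 0 - e * X 2 0| := abs_sub _ _
      _ ≤ 2 * ρ := by linarith [hY 0 2, hY 2 0]
  · show |(Y 1 0 - Y 0 1) - e * (X 1 0 - X 0 1)| ≤ 2 * ρ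
    calc |Y 1 0 - Y 0 1 - e * (X 1 0 - X 0 1)| = |(Y 1 0 - e * X 1 0) - (Y 0 1 - e * X 0 1)| := by ring_nf
      _ ≤ |Y 1 0 - e * X 1 0| + |Y 0 1 - e * X 0 1| := abs_sub _ _
      _ ≤ 2 * ρ := by linarith [hY 1 0, hY 0 1]

/-- `|vort X i| ≤ 2β`. [ours; elementary] -/
theorem abs_vort_le {X : Fin 3 → Fin 3 → ℝ} {β : ℝ} (hX : ∀ i j, |X i j| ≤ β) (i : Fin 3) : |vort X i| ≤ 2 * β := by
  have h := abs_vort_sub_le (X := X) (Y := fun _ _ => (0 : ℝ)) (e := -1) (ρ := β)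
    (fun i j => by simpa using hX i j) i
  have e : vort (fun _ _ => (0 : ℝ)) i = 0 := by fin_cases i <;> simp [vort]
  rw [e] at h
  simpa using h

/-- **Squared vorticity components under perturbation**: `|vort Y i² − e²·vort X i²| ≤ 8ρ(β+ρ)`. [ours] -/
theorem abs_vort_sq_sub_le {X Y : Fin 3 → Fin 3 → ℝ} {e β ρ : ℝ} (he : |e| ≤ 1) (hX : ∀ i j, |X i j| ≤ β)
    (hY : ∀ i j, |Y i j - e * X i j| ≤ ρ) (i : Fin 3) :
    |vort Y i ^ 2 - e ^ 2 * vort X i ^ 2| ≤ 8 * ρ * (β + ρ) := by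
  have hρ : 0 ≤ ρ := (abs_nonneg _).trans (hY 0 0)
  have h1 := abs_vort_sub_le hY i
  have h2 := abs_vort_le hX i
  have h3 : |e * vort X i| ≤ 2 * β := by
    rw [abs_mul]; exact (mul_le_mul he h2 (abs_nonneg _) zero_le_one).trans (by rw [one_mul])
  have h4 : |vort Y i + e * vort X i| ≤ 2 * ρ + 4 * β := by
    calc |vort Y i + e * vort X i| = |(vort Y i - e * vort X i) + 2 * (e * vort X i)| := by ring_nf
      _ ≤ |vort Y i - e * vort X i| + |2 * (e * vort X i)| := abs_add_le _ _
      _ ≤ 2 * ρ + 4 * β := by rw [abs_mul, abs_two]; linarith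
  calc |vort Y i ^ 2 - e ^ 2 * vort X i ^ 2| = |(vort Y i - e * vort X i) * (vort Y i + e * vort X i)| := by ring_nf
    _ = |vort Y i - e * vort X i| * |vort Y i + e * vort X i| := abs_mul _ _
    _ ≤ 2 * ρ * (2 * ρ + 4 * β) := mul_le_mul h1 h4 (abs_nonneg _) (by linarith)
    _ = 8 * ρ * (β + ρ) - 4 * ρ * ρ := by ring
    _ ≤ 8 * ρ * (β + ρ) := by nlinarith

/-- **Sup bound by Minkowski**: if `∑ vort X i² ≤ 1`, `0 ≤ e ≤ 1`, `|Y − eX| ≤ ρ` entrywise, then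
`∑ vort Y i² ≤ (1 + 4ρ)²`. [ours] -/
theorem sum_vort_sq_le {X Y : Fin 3 → Fin 3 → ℝ} {e ρ : ℝ} (he0 : 0 ≤ e) (he1 : e ≤ 1)
    (hX : ∑ i, vort X i ^ 2 ≤ 1) (hY : ∀ i j, |Y i j - e * X i j| ≤ ρ) :
    ∑ i, vort Y i ^ 2 ≤ (1 + 4 * ρ) ^ 2 := by
  have hρ : 0 ≤ ρ := (abs_nonneg _).trans (hY 0 0)
  set v : EuclideanSpace ℝ (Fin 3) := WithLp.toLp 2 (fun i => e * vort X i)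
  set w : EuclideanSpace ℝ (Fin 3) := WithLp.toLp 2 (vort Y)
  have hv : ‖v‖ ≤ 1 := by
    have h2 : ‖v‖ ^ 2 ≤ 1 := by
      rw [EuclideanSpace.norm_sq_eq]
      calc ∑ i, ‖v i‖ ^ 2 = e ^ 2 * ∑ i, vort X i ^ 2 := by
            simp only [v, Real.norm_eq_abs, sq_abs, Finset.mul_sum]
            refine Finset.sum_congr rfl fun i _ => by ring
        _ ≤ 1 * 1 := mul_le_mul (by nlinarith) hX (Finset.sum_nonneg fun i _ => sq_nonneg _) zero_le_one
        _ = 1 := by ring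
    nlinarith [norm_nonneg v]
  have hw : ‖w - v‖ ≤ 4 * ρ := by
    have h2 : ‖w - v‖ ^ 2 ≤ (4 * ρ) ^ 2 := by
      rw [EuclideanSpace.norm_sq_eq]
      calc ∑ i, ‖(w - v) i‖ ^ 2 = ∑ i, (vort Y i - e * vort X i) ^ 2 := by
            simp only [w, v, PiLp.sub_apply, Real.norm_eq_abs, sq_abs]
        _ ≤ ∑ _i : Fin 3, (2 * ρ) ^ 2 := Finset.sum_le_sum fun i _ => by
            have := abs_vort_sub_le hY i
            rw [← sq_abs]; exact pow_le_pow_left₀ (abs_nonneg _) this 2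
        _ = 12 * ρ ^ 2 := by simp; ring
        _ ≤ (4 * ρ) ^ 2 := by nlinarith
    nlinarith [norm_nonneg (w - v)]
  have hwn : ‖w‖ ≤ 1 + 4 * ρ := by
    calc ‖w‖ = ‖v + (w - v)‖ := by rw [add_sub_cancel]
      _ ≤ ‖v‖ + ‖w - v‖ := norm_add_le _ _
      _ ≤ 1 + 4 * ρ := add_le_add hv hw
  have : ∑ i, vort Y i ^ 2 = ‖w‖ ^ 2 := by
    rw [EuclideanSpace.norm_sq_eq]
    simp only [w, Real.norm_eq_abs, sq_abs]
  rw [this]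
  exact pow_le_pow_left₀ (norm_nonneg _) hwn 2

end Confinement

end Summit.NavierStokesRegularity.FunctionalMining

end
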